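import Summits.ABC.IUTFork.Joshi.ATS4DescentSpineGenuineResidual
import HarnessLib

/-!
# [J-IV] (arXiv:2403.10430v2) §6.10–§6.11: the LOWER-BOUND RESIDUAL (R5) of `abc_of_genuineResidual` asks NO MORE than Joshi's own
# inputs — it FOLLOWS, on EVERY carrier, from `LowerBound ∧ FrobShiftVol ∧ Eq6111 ∧ LogqDictionary` (R-J row Y-21, parent word, rider)

Proof-only sequel (0 defs) of `Joshi/ATS4DescentSpineGenuineResidual.lean` (abc-iut-E-t33 gen 6, p464392; R-J «JOSHI Y-DISCHARGE CENSUS»,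
rung LADDER-ABC:A2.RESCUE.J), answering in kernel the adversary question «is the residual (R5) weaker or stronger than print's lower
bound?»: on E-t31's carrier `LocusVolumeDatum` (p430311) the four named inputs ⟨LowerBound⟩ (Thm. 6.10.1 p.66 l.22–30 «−|log(q^{y₀}_ℓ)| ≤
−(1/ℓ*)|log Vol(hull(Θ̃^{𝓘,φ(y₀)}))|», [J-III] Cor. 9.11.1.1 at `φ(y₀)`), `FrobShiftVol` (p.66 l.25–37, «a tautology»), (6.11.1) `Eq6111`
(p.69 l.73 – p.70 l.3) and «(1/2ℓ) log(q) = |log(q_ℓ)|» `LogqDictionary` (p.71 l.107–110) IMPLY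
`−(1/2ℓ)·log q ≤ −(1/ℓ*)·(Σ_{p ∈ V^dst_ℚ} |log Vol_p| + |log Vol_∞|)` — the shape (R5) is handed over in. So (R5) is a CONSEQUENCE of
Joshi's inputs on every carrier (never stronger), and by p464392's `exists_glue_inputs_of_residual` it SUFFICES (with (R1)–(R4)) for
all nine: the residual is EXACT at the level of E-t31's reading predicates. Likewise (R4) IS `Prop6109` verbatim (`Iff.rfl` below).
SOURCE locators: the cell's render `HOME/lit/renders/Joshi-arxiv-2403.10430/`. FRAMING (binding): real-number bookkeeping on a typed
carrier; NO side taken on [IUTchIII] Cor. 3.12 / [IUTchIV] Thm. 1.10, on Joshi's claims or on Mochizuki's report on them; NOT an abc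
claim; typed ≠ proved ≠ endorsed. Theorems only; standard axioms; no `sorry`, instance, notation, `def` or new `Prop`.
[claim: Joshi2024ATS4, status: disputed]
-/

noncomputable section

namespace Summit.ABC.IUTFork.Joshi.ATS4

namespace LocusVolumeDatum

variable (d : LocusVolumeDatum)

/-- **(R5) ⟸ Joshi's four inputs, on EVERY carrier**: ⟨LowerBound⟩ ∧ `FrobShiftVol` ∧ (6.11.1) ∧ «(1/2ℓ) log q = |log q_ℓ|» give
`−(1/2ℓ)·log q ≤ −(1/ℓ*)·(Σ_{p∈V^dst}|log Vol_p| + |log Vol_∞|)`. PROVED (rewriting; `|log q_ℓ| > 0`). [claim: Joshi2024ATS4, status: disputed] -/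
theorem residualLowerBound_of_inputs (h₇ : d.LowerBound) (h₉ : d.FrobShiftVol) (h₁ : d.Eq6111) (hD : d.LogqDictionary) :
    -(1 / (2 * (d.l : ℝ)) * d.logq) ≤ -(1 / d.lstar) * (∑ p ∈ d.Vdst, |d.logVolAt p| + |d.logVolArch|) := by
  unfold LowerBound at h₇; unfold FrobShiftVol at h₉; unfold Eq6111 at h₁; unfold LogqDictionary at hD
  have hA := d.absLogThetaQ_pos
  rw [abs_of_pos hA, ← hD] at h₇
  rw [h₉, h₁] at h₇
  exact h₇

/-- **Conversely, on a carrier whose global slots are read by the [J-III] §9.11.1 convention** (`log Vol(hull^{φ(y₀)}) = log Vol(hull^{y₀})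
:= −(Σ_{p∈V^dst}|log Vol_p| + |log Vol_∞|)`, `|log q^{y₀}_ℓ| := (1/2ℓ)·log q` — the readings of p464392's built carrier), (R5) GIVES BACK
⟨LowerBound⟩ (and `FrobShiftVol`, (6.11.1), the dictionary hold by `rfl`-type rewriting). PROVED. [claim: Joshi2024ATS4, status: disputed] -/
theorem lowerBound_of_residual (hHullFrob : d.logVolHullFrob = -(∑ p ∈ d.Vdst, |d.logVolAt p| + |d.logVolArch|))
    (hQ : d.absLogThetaQ = 1 / (2 * (d.l : ℝ)) * d.logq)
    (hR5 : -(1 / (2 * (d.l : ℝ)) * d.logq) ≤ -(1 / d.lstar) * (∑ p ∈ d.Vdst, |d.logVolAt p| + |d.logVolArch|)) :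
    d.LowerBound := by
  unfold LowerBound
  have hA := d.absLogThetaQ_pos
  have hS : 0 ≤ ∑ p ∈ d.Vdst, |d.logVolAt p| + |d.logVolArch| :=
    add_nonneg (Finset.sum_nonneg fun p _ => abs_nonneg _) (abs_nonneg _)
  rw [abs_of_pos hA, hQ, hHullFrob, abs_neg, abs_of_nonneg hS]
  exact hR5

/-- **(R4) IS Prop. 6.10.9 verbatim** on a carrier whose `s_ℚ`/`s^≤` components are read by (6.7.2)/(6.7.6) (`log s_{ℚ,p} = log p`,
`log s^≤_p = ι_p·(log p)/p`) — nothing weaker or stronger is asked at the distinguished primes. PROVED (`Iff.rfl` after the readings).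
[claim: Joshi2024ATS4, status: disputed] -/
theorem prop6109_iff_residualStepV (p : ℕ) (N : ℕ) (hsQ : d.logsQAt p = Real.log p)
    (hsLe : d.logsLeAt p = if p ≤ N then Real.log p / p else 0) :
    d.Prop6109 p ↔ -(1 / d.lstar) * |d.logVolAt p| ≤ ((d.l : ℝ) + 1) / 4 *
      ((1 + 4 / (d.l : ℝ)) * d.logDiffLpAt p - 1 / 6 * d.logqAt p + 4 / (d.l : ℝ) * Real.log p
        + 20 / 3 * d.estar * (if p ≤ N then Real.log p / p else 0)) := by
  unfold Prop6109
  rw [hsQ, hsLe]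

end LocusVolumeDatum

end Summit.ABC.IUTFork.Joshi.ATS4

end
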